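import Mathlib
import HarnessLib
import Literature.Analysis.FluidPDE.RieszPressureModConst
import Literature.Analysis.FluidPDE.WholeSpaceIBP

/-!
# Route `PoloidalWindowDoor`, crux `PoloidalWindowRigidity` (stmt-19708), line `sparse_energy` — stub S1, FILE C
# (discharge of the window pressure split), pieces C3/C4: THE FAR PART OF THE SPLIT HAS DYADICALLY SMALL OSCILLATION

Seat ns-es-p1 g4 (prover; file `--supports stmt-NavierStokesRegularity-19708`; KEY-NS #134; division with the LEAD-lineage
K2-p2 g9/g10 recorded on pub/ns-regularity-ideate/STATUS 11:36Z/11:5xZ).  For a bounded continuous field `u` (`‖u‖ ≤ N`), a centre `a`,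
a radius `R > 0`, the cut field `w = ϑ • u` (`ϑ = cutoff (4R) (a − ·)`, `= 1` on `B̄(a,4R)`, supported in `B̄(a,8R)`) and the far kernel
`K = D²Γ∞^{r₀,r₁}` with `r₁ ≤ 2R`, the far part of the local pressure split

  `p₂ := farPotential r₀ r₁ w − farPotentialMod r₀ r₁ x₀ u`

has oscillation on `B̄(a,2R)` bounded by the dyadic far energies (`abs_farSplit_sub_le`):

  `|p₂ x − p₂ y| ≤ 64 M R · Σ'_k ((2^k R)⁻¹)⁴ ∫ cutoff (2^{k+1}R) (a − z) ‖u z‖² dz`,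

`M` the homogeneous constant of `‖D³Γ(z)‖ ≤ M‖z‖⁻⁴` (C3: `exists_norm_fderiv3_newtonKernel_le`, mean value on the convex ball,
`norm_kernel_sub_le_of_far`), the sources inside `B̄(a,4R)` cancelling exactly (`w = u` there) and the sources in the shell
`2^kR < ‖a−z‖ ≤ 2^{k+1}R` being dominated by `(2^kR)⁻⁴ cutoff(2^{k+1}R)(a−z)` (C4: `integral_far_le_tsum`, through `∫⁻` and `lintegral_tsum`).
This is the `O`-clause of the hypothesis `hwin` of `…SparseEnergyScaledEnergyOfSplit.scaledEnergy_of_split` (K2-p2 g9).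

WHAT THIS IS NOT: not a claim about Navier–Stokes; potential theory of bounded fields (bears_on LADDER-NS N0 via crux 19708, line sparse_energy,
stub S1).  No summit statement is proved here.
-/

noncomputable section

-- the summit and its single sub-problem share the name (CONVENTIONS §1), as in every Theorems file
set_option linter.dupNamespace false

namespace Summit.NavierStokesRegularity.NavierStokesRegularity.Theorems.PoloidalWindowDoorPoloidalWindowRigiditySparseEnergyPressureSplitFar

-- nested operator types `ℝ³ →L[ℝ] ℝ³ →L[ℝ] ℝ³ →L[ℝ] ℝ`
set_option maxSynthPendingDepth 3

open MeasureTheory Set Function Filter Topology Metric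
open scoped ENNReal
open Literature.Analysis Literature.Analysis.FluidPDE

/-! ### C3: the far kernel -/

/-- **`‖D³Γ(z)‖ ≤ M ‖z‖⁻⁴` for all `z ≠ 0`** (homogeneity of degree `−4` and continuity on the unit sphere). -/
theorem exists_norm_fderiv3_newtonKernel_le :
    ∃ M : ℝ, 0 ≤ M ∧ ∀ z : EuclideanSpace ℝ (Fin 3), z ≠ 0 →
      ‖fderiv ℝ (fderiv ℝ (fderiv ℝ newtonKernel)) z‖ ≤ M * (‖z‖ ^ 4)⁻¹ := by
  obtain ⟨M, hM0, hM⟩ := PineauVicol2026.exists_decay_of_homogeneous _ (-4) (by norm_num)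
    fderiv3_newtonKernel_homogeneous (contDiffOn_fderiv3_newtonKernel (n := 0)).continuousOn
  refine ⟨M, hM0, fun z hz => ?_⟩
  set Φ := fderiv ℝ (fderiv ℝ (fderiv ℝ newtonKernel)) with hΦ
  have hz0 : 0 < ‖z‖ := norm_pos_iff.2 hz
  -- rescale to the unit sphere
  set e : EuclideanSpace ℝ (Fin 3) := ‖z‖⁻¹ • z with he
  have he1 : ‖e‖ = 1 := by rw [he, norm_smul, norm_inv, norm_norm, inv_mul_cancel₀ hz0.ne']
  have hze : z = ‖z‖ • e := by rw [he, smul_smul, mul_inv_cancel₀ hz0.ne', one_smul]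
  have h1 : ‖Φ e‖ ≤ M := by
    have := hM e (by rw [he1])
    rwa [he1, one_zpow, mul_one] at this
  have h2 : Φ z = ‖z‖ ^ (-4 : ℤ) • Φ e := by
    conv_lhs => rw [hze]
    exact fderiv3_newtonKernel_homogeneous ‖z‖ hz0 e
  rw [h2, norm_smul, norm_zpow, norm_norm, show (-4 : ℤ) = -((4 : ℕ) : ℤ) by norm_num, zpow_neg, zpow_natCast,
    mul_comm]
  exact mul_le_mul_of_nonneg_right h1 (by positivity)

variable {r₀ r₁ : ℝ}

/-- `D³Γ∞^{r₀,r₁}(z) = D³Γ(z)` has norm `≤ M‖z‖⁻⁴` off the ball of radius `r₁`. -/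
theorem norm_fderiv3_newtonFar_le (h₀ : 0 < r₀) (h₁ : r₀ < r₁) {M : ℝ}
    (hM : ∀ z : EuclideanSpace ℝ (Fin 3), z ≠ 0 → ‖fderiv ℝ (fderiv ℝ (fderiv ℝ newtonKernel)) z‖ ≤ M * (‖z‖ ^ 4)⁻¹)
    {z : EuclideanSpace ℝ (Fin 3)} (hz : r₁ < ‖z‖) :
    ‖fderiv ℝ (fderiv ℝ (fderiv ℝ (newtonFar r₀ r₁))) z‖ ≤ M * (‖z‖ ^ 4)⁻¹ := by
  have hz0 : z ≠ 0 := by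
    intro h; rw [h, norm_zero] at hz; linarith
  rw [(newtonFar_fderiv_iterates_eq h₀.le h₁ hz).2.2.2.1]
  exact hM z hz0

/-- **Mean value on the ball, far sources**: for `r₁ ≤ 2R`, a source point `z` with `4R < ‖a − z‖` and `x, y ∈ B̄(a,2R)`,
`‖D²Γ∞(x−z) − D²Γ∞(y−z)‖ ≤ ‖x − y‖ · 16 M ‖a − z‖⁻⁴` (along the segment the kernel is `D²Γ`, whose derivative is
`≤ M(‖a−z‖/2)⁻⁴`). -/
theorem norm_kernel_sub_le_of_far (h₀ : 0 < r₀) (h₁ : r₀ < r₁) {R : ℝ} (hr : r₁ ≤ 2 * R) {M : ℝ} (hM0 : 0 ≤ M)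
    (hM : ∀ z : EuclideanSpace ℝ (Fin 3), z ≠ 0 → ‖fderiv ℝ (fderiv ℝ (fderiv ℝ newtonKernel)) z‖ ≤ M * (‖z‖ ^ 4)⁻¹)
    {a z : EuclideanSpace ℝ (Fin 3)} (hz : 4 * R < ‖a - z‖) {x y : EuclideanSpace ℝ (Fin 3)}
    (hx : x ∈ closedBall a (2 * R)) (hy : y ∈ closedBall a (2 * R)) :
    ‖fderiv ℝ (fderiv ℝ (newtonFar r₀ r₁)) (x - z) - fderiv ℝ (fderiv ℝ (newtonFar r₀ r₁)) (y - z)‖ ≤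
      ‖x - y‖ * (16 * M * (‖a - z‖ ^ 4)⁻¹) := by
  set K := fderiv ℝ (fderiv ℝ (newtonFar r₀ r₁)) with hK
  have hKd : Differentiable ℝ K := (contDiff_fderiv2_newtonFar h₀ h₁).differentiable two_ne_zero
  have hRpos : 0 < R := by linarith
  have haz : 0 < ‖a - z‖ := by linarith
  -- derivative bound on the ball
  have hbound : ∀ ξ ∈ closedBall a (2 * R), ‖fderiv ℝ (fun ξ => K (ξ - z)) ξ‖ ≤ 16 * M * (‖a - z‖ ^ 4)⁻¹ := by
    intro ξ hξ
    rw [mem_closedBall, dist_eq_norm] at hξ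
    have e : fderiv ℝ (fun ξ => K (ξ - z)) ξ = fderiv ℝ K (ξ - z) := by
      simpa only [sub_eq_add_neg] using fderiv_comp_add_right (f := K) (x := ξ) (-z)
    rw [e]
    have hξz : ‖a - z‖ / 2 ≤ ‖ξ - z‖ := by
      have : ‖a - z‖ ≤ ‖a - ξ‖ + ‖ξ - z‖ := norm_sub_le_norm_sub_add_norm_sub a ξ z
      rw [norm_sub_rev a ξ] at this
      linarith
    have hξz1 : r₁ < ‖ξ - z‖ := by linarith
    have hξz0 : 0 < ‖ξ - z‖ := by linarith
    calc ‖fderiv ℝ K (ξ - z)‖ ≤ M * (‖ξ - z‖ ^ 4)⁻¹ := norm_fderiv3_newtonFar_le h₀ h₁ hM hξz1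
      _ ≤ M * ((‖a - z‖ / 2) ^ 4)⁻¹ := by
          refine mul_le_mul_of_nonneg_left (inv_anti₀ (by positivity) ?_) hM0
          exact pow_le_pow_left₀ (by positivity) hξz 4
      _ = 16 * M * (‖a - z‖ ^ 4)⁻¹ := by field_simp; ring
  have hdiff : ∀ ξ ∈ closedBall a (2 * R), DifferentiableAt ℝ (fun ξ => K (ξ - z)) ξ := fun ξ _ =>
    (hKd (ξ - z)).comp ξ (differentiableAt_id.sub (differentiableAt_const z))
  have h := (convex_closedBall a (2 * R)).norm_image_sub_le_of_norm_fderiv_le hdiff hbound hy hx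
  exact h.trans (le_of_eq (by ring))

/-! ### C4: dyadic domination of the far energy -/

/-- The dyadic far energies are summable: `((2^kR)⁻¹)⁴ ∫ cutoff(2^{k+1}R)(a−z)‖u z‖² dz ≤ 64 N² |B̄₁| R⁻¹ 2⁻ᵏ` for `‖u‖ ≤ N`. -/
theorem summable_dyadic_far_energy {u : EuclideanSpace ℝ (Fin 3) → EuclideanSpace ℝ (Fin 3)} (hu : Continuous u) {N : ℝ}
    (hN : ∀ z, ‖u z‖ ≤ N) (a : EuclideanSpace ℝ (Fin 3)) {R : ℝ} (hR : 0 < R) :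
    (∀ k : ℕ, 0 ≤ ((2 : ℝ) ^ k * R)⁻¹ ^ 4 * ∫ z, cutoff ((2 : ℝ) ^ (k + 1) * R) (a - z) * ‖u z‖ ^ 2) ∧
    (∀ k : ℕ, Integrable fun z => cutoff ((2 : ℝ) ^ (k + 1) * R) (a - z) * ‖u z‖ ^ 2) ∧
    Summable fun k : ℕ => ((2 : ℝ) ^ k * R)⁻¹ ^ 4 * ∫ z, cutoff ((2 : ℝ) ^ (k + 1) * R) (a - z) * ‖u z‖ ^ 2 := by
  set V₁ : ℝ := (volume : Measure (EuclideanSpace ℝ (Fin 3))).real (closedBall (0 : EuclideanSpace ℝ (Fin 3)) 1) with hV₁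
  have hN0 : 0 ≤ N := (norm_nonneg _).trans (hN 0)
  have hpos : ∀ k : ℕ, 0 < (2 : ℝ) ^ (k + 1) * R := fun k => by positivity
  have hnn : ∀ k z, 0 ≤ cutoff ((2 : ℝ) ^ (k + 1) * R) (a - z) * ‖u z‖ ^ 2 := fun k z =>
    mul_nonneg (cutoff_nonneg _ _) (sq_nonneg _)
  have hsupp : ∀ k z, z ∉ closedBall a (2 * ((2 : ℝ) ^ (k + 1) * R)) →
      cutoff ((2 : ℝ) ^ (k + 1) * R) (a - z) * ‖u z‖ ^ 2 = 0 := fun k z hz => by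
    rw [mem_closedBall, dist_eq_norm, not_le, norm_sub_rev] at hz
    rw [cutoff_eq_zero (hpos k) hz.le, zero_mul]
  have hint : ∀ k : ℕ, Integrable fun z => cutoff ((2 : ℝ) ^ (k + 1) * R) (a - z) * ‖u z‖ ^ 2 := fun k =>
    (((contDiff_cutoff (n := 0) _).continuous.comp (continuous_const.sub continuous_id)).mul
      (hu.norm.pow 2)).integrable_of_hasCompactSupport
      (HasCompactSupport.intro (isCompact_closedBall a _) (hsupp k))
  have hle : ∀ k : ℕ, ∫ z, cutoff ((2 : ℝ) ^ (k + 1) * R) (a - z) * ‖u z‖ ^ 2 ≤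
      N ^ 2 * ((2 * ((2 : ℝ) ^ (k + 1) * R)) ^ 3 * V₁) := fun k => by
    have h1 : ∀ z, cutoff ((2 : ℝ) ^ (k + 1) * R) (a - z) * ‖u z‖ ^ 2 ≤
        (closedBall a (2 * ((2 : ℝ) ^ (k + 1) * R))).indicator (fun _ => N ^ 2) z := fun z => by
      by_cases hz : z ∈ closedBall a (2 * ((2 : ℝ) ^ (k + 1) * R))
      · rw [indicator_of_mem hz]
        calc cutoff ((2 : ℝ) ^ (k + 1) * R) (a - z) * ‖u z‖ ^ 2 ≤ 1 * ‖u z‖ ^ 2 :=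
              mul_le_mul_of_nonneg_right (cutoff_le_one _ _) (sq_nonneg _)
          _ ≤ N ^ 2 := by rw [one_mul]; exact pow_le_pow_left₀ (norm_nonneg _) (hN z) 2
      · rw [hsupp k z hz, indicator_of_notMem hz]
    have h2 := integral_mono (hint k) ((integrable_indicator_iff measurableSet_closedBall).2
      (integrableOn_const measure_closedBall_lt_top.ne)) h1
    refine h2.trans (le_of_eq ?_)
    rw [integral_indicator measurableSet_closedBall, setIntegral_const, smul_eq_mul,
      Measure.addHaar_real_closedBall' volume a (by positivity), finrank_euclideanSpace_fin, ← hV₁]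
    ring
  refine ⟨fun k => mul_nonneg (by positivity) (integral_nonneg (hnn k)), hint, ?_⟩
  -- comparison with a geometric series
  have hgeom : Summable fun k : ℕ => (64 * N ^ 2 * V₁ * R⁻¹) * (2⁻¹ : ℝ) ^ k :=
    (summable_geometric_of_lt_one (by norm_num) (by norm_num)).mul_left _
  refine Summable.of_nonneg_of_le (fun k => mul_nonneg (by positivity) (integral_nonneg (hnn k))) (fun k => ?_) hgeom
  calc ((2 : ℝ) ^ k * R)⁻¹ ^ 4 * ∫ z, cutoff ((2 : ℝ) ^ (k + 1) * R) (a - z) * ‖u z‖ ^ 2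
      ≤ ((2 : ℝ) ^ k * R)⁻¹ ^ 4 * (N ^ 2 * ((2 * ((2 : ℝ) ^ (k + 1) * R)) ^ 3 * V₁)) :=
        mul_le_mul_of_nonneg_left (hle k) (by positivity)
    _ = (64 * N ^ 2 * V₁ * R⁻¹) * (2⁻¹ : ℝ) ^ k := by
        have h2k : (2 : ℝ) ^ k ≠ 0 := pow_ne_zero _ two_ne_zero
        have hR0 : R ≠ 0 := hR.ne'
        rw [inv_pow, inv_pow]
        field_simp
        ring

/-- **Dyadic domination of the far weight**: for `4R < ‖a − z‖`,
`‖a − z‖⁻⁴ ≤ Σ'_k ((2^kR)⁻¹)⁴ cutoff(2^{k+1}R)(a − z)` (the shell `2^kR ≤ ‖a−z‖ < 2^{k+1}R` contributes `(2^kR)⁻⁴ · 1`). -/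
theorem inv_pow_four_le_tsum_cutoff {R : ℝ} (hR : 0 < R) {a z : EuclideanSpace ℝ (Fin 3)} (hz : 4 * R < ‖a - z‖) :
    (Summable fun k : ℕ => ((2 : ℝ) ^ k * R)⁻¹ ^ 4 * cutoff ((2 : ℝ) ^ (k + 1) * R) (a - z)) ∧
    (‖a - z‖ ^ 4)⁻¹ ≤ ∑' k : ℕ, ((2 : ℝ) ^ k * R)⁻¹ ^ 4 * cutoff ((2 : ℝ) ^ (k + 1) * R) (a - z) := by
  have hnn : ∀ k : ℕ, 0 ≤ ((2 : ℝ) ^ k * R)⁻¹ ^ 4 * cutoff ((2 : ℝ) ^ (k + 1) * R) (a - z) := fun k =>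
    mul_nonneg (by positivity) (cutoff_nonneg _ _)
  have hsum : Summable fun k : ℕ => ((2 : ℝ) ^ k * R)⁻¹ ^ 4 * cutoff ((2 : ℝ) ^ (k + 1) * R) (a - z) := by
    have hgeom : Summable fun k : ℕ => R⁻¹ ^ 4 * (16⁻¹ : ℝ) ^ k :=
      (summable_geometric_of_lt_one (by norm_num) (by norm_num)).mul_left _
    refine Summable.of_nonneg_of_le hnn (fun k => ?_) hgeom
    calc ((2 : ℝ) ^ k * R)⁻¹ ^ 4 * cutoff ((2 : ℝ) ^ (k + 1) * R) (a - z) ≤ ((2 : ℝ) ^ k * R)⁻¹ ^ 4 * 1 :=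
          mul_le_mul_of_nonneg_left (cutoff_le_one _ _) (by positivity)
      _ = R⁻¹ ^ 4 * (16⁻¹ : ℝ) ^ k := by
          have e16 : ((2 : ℝ) ^ k) ^ 4 = 16 ^ k := by rw [← pow_mul, mul_comm, pow_mul]; norm_num
          have h2k : (2 : ℝ) ^ k ≠ 0 := pow_ne_zero _ two_ne_zero
          have hR0 : R ≠ 0 := hR.ne'
          rw [inv_pow, inv_pow, inv_pow, ← e16]
          field_simp
  refine ⟨hsum, ?_⟩
  -- the shell index
  have hx : 1 ≤ ‖a - z‖ / R := by rw [le_div_iff₀ hR]; linarith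
  obtain ⟨n, hn1, hn2⟩ := exists_nat_pow_near hx one_lt_two
  have hn1' : (2 : ℝ) ^ n * R ≤ ‖a - z‖ := by rwa [le_div_iff₀ hR] at hn1
  have hn2' : ‖a - z‖ ≤ (2 : ℝ) ^ (n + 1) * R := by rw [div_lt_iff₀ hR] at hn2; exact hn2.le
  have hcut : cutoff ((2 : ℝ) ^ (n + 1) * R) (a - z) = 1 := cutoff_eq_one (by positivity) hn2'
  calc (‖a - z‖ ^ 4)⁻¹ ≤ ((2 : ℝ) ^ n * R)⁻¹ ^ 4 * cutoff ((2 : ℝ) ^ (n + 1) * R) (a - z) := by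
        rw [hcut, mul_one, inv_pow]
        exact inv_anti₀ (by positivity) (pow_le_pow_left₀ (by positivity) hn1' 4)
    _ ≤ ∑' k : ℕ, ((2 : ℝ) ^ k * R)⁻¹ ^ 4 * cutoff ((2 : ℝ) ^ (k + 1) * R) (a - z) := hsum.le_tsum n fun k _ => hnn k

/-- **The far energy is dominated by the dyadic cut-off energies**: with `F(z) = ‖a−z‖⁻⁴‖u z‖²` for `‖a − z‖ > 4R` and `0`
otherwise, `F` is integrable and `∫ F ≤ Σ'_k ((2^kR)⁻¹)⁴ ∫ cutoff(2^{k+1}R)(a−z)‖u z‖² dz` (through `∫⁻`, `lintegral_tsum`). -/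
theorem integral_far_le_tsum {u : EuclideanSpace ℝ (Fin 3) → EuclideanSpace ℝ (Fin 3)} (hu : Continuous u) {N : ℝ}
    (hN : ∀ z, ‖u z‖ ≤ N) (a : EuclideanSpace ℝ (Fin 3)) {R : ℝ} (hR : 0 < R) :
    Integrable (fun z => {z | 4 * R < ‖a - z‖}.indicator (fun z => (‖a - z‖ ^ 4)⁻¹ * ‖u z‖ ^ 2) z) ∧
    ∫ z, {z | 4 * R < ‖a - z‖}.indicator (fun z => (‖a - z‖ ^ 4)⁻¹ * ‖u z‖ ^ 2) z ≤
      ∑' k : ℕ, ((2 : ℝ) ^ k * R)⁻¹ ^ 4 * ∫ z, cutoff ((2 : ℝ) ^ (k + 1) * R) (a - z) * ‖u z‖ ^ 2 := by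
  obtain ⟨hnn, hint, hsum⟩ := summable_dyadic_far_energy hu hN a hR
  set S : Set (EuclideanSpace ℝ (Fin 3)) := {z | 4 * R < ‖a - z‖} with hS
  have hSm : MeasurableSet S := measurableSet_lt measurable_const (continuous_const.sub continuous_id).norm.measurable
  set F : EuclideanSpace ℝ (Fin 3) → ℝ := fun z => S.indicator (fun z => (‖a - z‖ ^ 4)⁻¹ * ‖u z‖ ^ 2) z with hF
  set g : ℕ → EuclideanSpace ℝ (Fin 3) → ℝ := fun k z =>
    ((2 : ℝ) ^ k * R)⁻¹ ^ 4 * (cutoff ((2 : ℝ) ^ (k + 1) * R) (a - z) * ‖u z‖ ^ 2) with hg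
  have hF0 : ∀ z, 0 ≤ F z := fun z => by
    simp only [hF]; exact indicator_nonneg (fun _ _ => by positivity) _
  have hg0 : ∀ k z, 0 ≤ g k z := fun k z => by
    simp only [hg]; exact mul_nonneg (by positivity) (mul_nonneg (cutoff_nonneg _ _) (sq_nonneg _))
  have hgi : ∀ k, Integrable (g k) := fun k => (hint k).const_mul _
  -- measurability of `F`
  have hFm : AEStronglyMeasurable F volume := by
    have hc : ContinuousOn (fun z => (‖a - z‖ ^ 4)⁻¹ * ‖u z‖ ^ 2) S := by
      refine ContinuousOn.mul (ContinuousOn.inv₀ ((continuous_const.sub continuous_id).norm.pow 4).continuousOn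
        fun z hz => ?_) (hu.norm.pow 2).continuousOn
      have : 0 < ‖a - z‖ := by simp only [hS, mem_setOf_eq] at hz; linarith
      positivity
    simpa only [hF] using (aestronglyMeasurable_indicator_iff (μ := volume) hSm).2
      (hc.aestronglyMeasurable (μ := volume) hSm)
  -- pointwise domination `F ≤ Σ' g k`
  have hdom : ∀ z, F z ≤ ∑' k, g k z := by
    intro z
    by_cases hz : z ∈ S
    · simp only [hF, indicator_of_mem hz]
      have hz' : 4 * R < ‖a - z‖ := hz
      obtain ⟨hs, hle⟩ := inv_pow_four_le_tsum_cutoff hR hz'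
      have e' : ∀ k, g k z = (((2 : ℝ) ^ k * R)⁻¹ ^ 4 * cutoff ((2 : ℝ) ^ (k + 1) * R) (a - z)) * ‖u z‖ ^ 2 :=
        fun k => by simp only [hg]; ring
      have e : ∑' k, g k z = (∑' k, ((2 : ℝ) ^ k * R)⁻¹ ^ 4 * cutoff ((2 : ℝ) ^ (k + 1) * R) (a - z)) * ‖u z‖ ^ 2 := by
        rw [tsum_congr e']; exact tsum_mul_right
      rw [e]
      exact mul_le_mul_of_nonneg_right hle (sq_nonneg _)
    · simp only [hF, indicator_of_notMem hz]
      exact tsum_nonneg fun k => hg0 k z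
  have hsumz : ∀ z, Summable fun k => g k z := fun z => by
    by_cases hz : 4 * R < ‖a - z‖
    · have := (inv_pow_four_le_tsum_cutoff hR hz).1.mul_right (‖u z‖ ^ 2)
      refine this.congr fun k => ?_
      simp only [hg]; ring
    · -- dominated by the geometric series
      have hgeom : Summable fun k : ℕ => R⁻¹ ^ 4 * N ^ 2 * (16⁻¹ : ℝ) ^ k :=
        (summable_geometric_of_lt_one (by norm_num) (by norm_num)).mul_left _
      refine Summable.of_nonneg_of_le (fun k => hg0 k z) (fun k => ?_) hgeom
      simp only [hg]
      have hN0 : 0 ≤ N := (norm_nonneg _).trans (hN 0)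
      calc ((2 : ℝ) ^ k * R)⁻¹ ^ 4 * (cutoff ((2 : ℝ) ^ (k + 1) * R) (a - z) * ‖u z‖ ^ 2)
          ≤ ((2 : ℝ) ^ k * R)⁻¹ ^ 4 * (1 * N ^ 2) := by
            refine mul_le_mul_of_nonneg_left ?_ (by positivity)
            exact mul_le_mul (cutoff_le_one _ _) (pow_le_pow_left₀ (norm_nonneg _) (hN z) 2) (sq_nonneg _) zero_le_one
        _ = R⁻¹ ^ 4 * N ^ 2 * (16⁻¹ : ℝ) ^ k := by
            have e16 : ((2 : ℝ) ^ k) ^ 4 = 16 ^ k := by rw [← pow_mul, mul_comm, pow_mul]; norm_num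
            have h2k : (2 : ℝ) ^ k ≠ 0 := pow_ne_zero _ two_ne_zero
            have hR0 : R ≠ 0 := hR.ne'
            rw [inv_pow, inv_pow, inv_pow, ← e16]
            field_simp
  -- the `∫⁻` computation
  have hlin : ∫⁻ z, ENNReal.ofReal (F z) ≤ ENNReal.ofReal (∑' k, ∫ z, g k z) := by
    calc ∫⁻ z, ENNReal.ofReal (F z) ≤ ∫⁻ z, ∑' k, ENNReal.ofReal (g k z) := by
          refine lintegral_mono fun z => ?_
          rw [← ENNReal.ofReal_tsum_of_nonneg (fun k => hg0 k z) (hsumz z)]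
          exact ENNReal.ofReal_le_ofReal (hdom z)
      _ = ∑' k, ∫⁻ z, ENNReal.ofReal (g k z) :=
          lintegral_tsum fun k => (hgi k).aestronglyMeasurable.aemeasurable.ennreal_ofReal
      _ = ∑' k, ENNReal.ofReal (∫ z, g k z) := by
          congr 1; funext k
          rw [ofReal_integral_eq_lintegral_ofReal (hgi k) (ae_of_all _ (hg0 k))]
      _ = ENNReal.ofReal (∑' k, ∫ z, g k z) := by
          rw [ENNReal.ofReal_tsum_of_nonneg (fun k => integral_nonneg (hg0 k)) ?_]
          simpa only [hg, integral_const_mul] using hsum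
  have hFi : Integrable F := by
    refine ⟨hFm, ?_⟩
    rw [hasFiniteIntegral_iff_ofReal (ae_of_all _ hF0)]
    exact hlin.trans_lt ENNReal.ofReal_lt_top
  refine ⟨hFi, ?_⟩
  have h1 : ∫ z, F z = (∫⁻ z, ENNReal.ofReal (F z)).toReal := integral_eq_lintegral_of_nonneg_ae (ae_of_all _ hF0) hFm
  rw [h1]
  have h2 := ENNReal.toReal_mono ENNReal.ofReal_ne_top hlin
  rw [ENNReal.toReal_ofReal (tsum_nonneg fun k => integral_nonneg (hg0 k))] at h2
  refine h2.trans (le_of_eq ?_)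
  simp only [hg, integral_const_mul]

/-! ### The oscillation of the far split -/

/-- The cut field `w = ϑ • u`, `ϑ = cutoff (4R) (a − ·)`: continuous, `‖w‖ ≤ ‖u‖`, `w = u` on `B̄(a,4R)`, `w = 0` off `B̄(a,8R)`,
hence `|w|² ∈ L¹`. -/
theorem cutField_props {u : EuclideanSpace ℝ (Fin 3) → EuclideanSpace ℝ (Fin 3)} (hu : Continuous u) (a : EuclideanSpace ℝ (Fin 3))
    {R : ℝ} (hR : 0 < R) :
    Continuous (fun z => cutoff (4 * R) (a - z) • u z) ∧
    (∀ z, ‖cutoff (4 * R) (a - z) • u z‖ ≤ ‖u z‖) ∧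
    (∀ z, ‖a - z‖ ≤ 4 * R → cutoff (4 * R) (a - z) • u z = u z) ∧
    (∀ z, 8 * R ≤ ‖a - z‖ → cutoff (4 * R) (a - z) • u z = 0) ∧
    Integrable (fun z => ‖cutoff (4 * R) (a - z) • u z‖ ^ 2) := by
  have hϑc : Continuous fun z => cutoff (4 * R) (a - z) :=
    (contDiff_cutoff (n := 0) _).continuous.comp (continuous_const.sub continuous_id)
  have hwc : Continuous fun z => cutoff (4 * R) (a - z) • u z := hϑc.smul hu
  have hle : ∀ z, ‖cutoff (4 * R) (a - z) • u z‖ ≤ ‖u z‖ := fun z => by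
    rw [norm_smul, Real.norm_eq_abs, abs_of_nonneg (cutoff_nonneg _ _)]
    exact mul_le_of_le_one_left (norm_nonneg _) (cutoff_le_one _ _)
  have hone : ∀ z, ‖a - z‖ ≤ 4 * R → cutoff (4 * R) (a - z) • u z = u z := fun z hz => by
    rw [cutoff_eq_one (by positivity) hz, one_smul]
  have hzero : ∀ z, 8 * R ≤ ‖a - z‖ → cutoff (4 * R) (a - z) • u z = 0 := fun z hz => by
    rw [cutoff_eq_zero (by positivity) (by linarith), zero_smul]
  refine ⟨hwc, hle, hone, hzero, ?_⟩
  refine (hwc.norm.pow 2).integrable_of_hasCompactSupport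
    (HasCompactSupport.intro (isCompact_closedBall a (8 * R)) fun z hz => ?_)
  rw [mem_closedBall, dist_eq_norm, norm_sub_rev, not_le] at hz
  simp [hzero z hz.le]

/-- **C4 — THE FAR PART OF THE LOCAL PRESSURE SPLIT HAS DYADICALLY SMALL OSCILLATION.**  For a bounded continuous field `u`
(`‖u‖ ≤ N`), radii `0 < r₀ < r₁ ≤ 2R`, the cut field `w = cutoff(4R)(a − ·) • u`, any base point `x₀`, and `x, y ∈ B̄(a,2R)`:
`|p₂ x − p₂ y| ≤ 64 M R Σ'_k ((2^kR)⁻¹)⁴ ∫ cutoff(2^{k+1}R)(a−z)‖u z‖² dz`, `p₂ = farPotential r₀ r₁ w − farPotentialMod r₀ r₁ x₀ u`,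
`M` the constant of `‖D³Γ(z)‖ ≤ M‖z‖⁻⁴` (the sources in `B̄(a,4R)` cancel since `w = u` there; outside, mean value + dyadic domination). -/
theorem abs_farSplit_sub_le (h₀ : 0 < r₀) (h₁ : r₀ < r₁) {R : ℝ} (hR : 0 < R) (hr : r₁ ≤ 2 * R)
    {u : EuclideanSpace ℝ (Fin 3) → EuclideanSpace ℝ (Fin 3)} (hu : Continuous u) {N : ℝ} (hN : ∀ z, ‖u z‖ ≤ N)
    (a x₀ : EuclideanSpace ℝ (Fin 3)) {M : ℝ} (hM0 : 0 ≤ M)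
    (hM : ∀ z : EuclideanSpace ℝ (Fin 3), z ≠ 0 → ‖fderiv ℝ (fderiv ℝ (fderiv ℝ newtonKernel)) z‖ ≤ M * (‖z‖ ^ 4)⁻¹)
    {x y : EuclideanSpace ℝ (Fin 3)} (hx : x ∈ closedBall a (2 * R)) (hy : y ∈ closedBall a (2 * R)) :
    |(farPotential r₀ r₁ (fun z => cutoff (4 * R) (a - z) • u z) x - farPotentialMod r₀ r₁ x₀ u x) -
        (farPotential r₀ r₁ (fun z => cutoff (4 * R) (a - z) • u z) y - farPotentialMod r₀ r₁ x₀ u y)| ≤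
      64 * M * R * ∑' k : ℕ, ((2 : ℝ) ^ k * R)⁻¹ ^ 4 * ∫ z, cutoff ((2 : ℝ) ^ (k + 1) * R) (a - z) * ‖u z‖ ^ 2 := by
  obtain ⟨hwc, hwle, hwone, -, hL2w⟩ := cutField_props hu a hR
  set w : EuclideanSpace ℝ (Fin 3) → EuclideanSpace ℝ (Fin 3) := fun z => cutoff (4 * R) (a - z) • u z with hw
  set K := fderiv ℝ (fderiv ℝ (newtonFar r₀ r₁)) with hK
  set D : EuclideanSpace ℝ (Fin 3) → (EuclideanSpace ℝ (Fin 3) →L[ℝ] EuclideanSpace ℝ (Fin 3) →L[ℝ] ℝ) :=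
    fun z => K (x - z) - K (y - z) with hD
  obtain ⟨hFi, hFle⟩ := integral_far_le_tsum hu hN a hR
  set S : Set (EuclideanSpace ℝ (Fin 3)) := {z | 4 * R < ‖a - z‖} with hS
  -- the two differences as integrals of `D`
  have e1 : farPotential r₀ r₁ w x - farPotential r₀ r₁ w y = ∫ z, D z (w z) (w z) := by
    unfold farPotential
    rw [← integral_sub (integrable_farPotential_integrand h₀ h₁ hwc hL2w x)
      (integrable_farPotential_integrand h₀ h₁ hwc hL2w y)]
    refine integral_congr_ae (Eventually.of_forall fun z => ?_)
    simp only [hD, hK, sub_apply]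
  have e2 : farPotentialMod r₀ r₁ x₀ u x - farPotentialMod r₀ r₁ x₀ u y = ∫ z, D z (u z) (u z) :=
    farPotentialMod_sub_farPotentialMod h₀ h₁ hu hN x₀ x y
  have i1 : Integrable fun z => D z (w z) (w z) := by
    have := (integrable_farPotential_integrand h₀ h₁ hwc hL2w x).sub (integrable_farPotential_integrand h₀ h₁ hwc hL2w y)
    refine this.congr (Eventually.of_forall fun z => ?_)
    simp only [hD, hK, sub_apply, Pi.sub_apply]
  have i2 : Integrable fun z => D z (u z) (u z) := integrable_farPotentialMod_integrand h₀ h₁ hu hN y x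
  have e3 : (farPotential r₀ r₁ w x - farPotentialMod r₀ r₁ x₀ u x) -
      (farPotential r₀ r₁ w y - farPotentialMod r₀ r₁ x₀ u y) = ∫ z, (D z (w z) (w z) - D z (u z) (u z)) := by
    rw [integral_sub i1 i2, ← e1, ← e2]; ring
  -- pointwise: `D(w,w) − D(u,u) = (ϑ² − 1) D(u,u)`, vanishing on `B̄(a,4R)`, small outside
  have hxy : ‖x - y‖ ≤ 4 * R := by
    rw [mem_closedBall, dist_eq_norm] at hx hy
    calc ‖x - y‖ ≤ ‖x - a‖ + ‖a - y‖ := norm_sub_le_norm_sub_add_norm_sub x a y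
      _ ≤ 2 * R + 2 * R := add_le_add hx (by rw [norm_sub_rev]; exact hy)
      _ = 4 * R := by ring
  have hpt : ∀ z, ‖D z (w z) (w z) - D z (u z) (u z)‖ ≤
      64 * M * R * S.indicator (fun z => (‖a - z‖ ^ 4)⁻¹ * ‖u z‖ ^ 2) z := by
    intro z
    have hϑ0 : 0 ≤ cutoff (4 * R) (a - z) := cutoff_nonneg _ _
    have hϑ1 : cutoff (4 * R) (a - z) ≤ 1 := cutoff_le_one _ _
    have hsm : D z (w z) (w z) = cutoff (4 * R) (a - z) ^ 2 * D z (u z) (u z) := by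
      simp only [hw, map_smul, smul_apply, smul_eq_mul]; ring
    rw [hsm, show cutoff (4 * R) (a - z) ^ 2 * D z (u z) (u z) - D z (u z) (u z) =
      (cutoff (4 * R) (a - z) ^ 2 - 1) * D z (u z) (u z) by ring]
    by_cases hz : z ∈ S
    · rw [indicator_of_mem hz]
      have hz' : 4 * R < ‖a - z‖ := hz
      have hDn : ‖D z‖ ≤ ‖x - y‖ * (16 * M * (‖a - z‖ ^ 4)⁻¹) :=
        norm_kernel_sub_le_of_far h₀ h₁ hr hM0 hM hz' hx hy
      have hc1 : |cutoff (4 * R) (a - z) ^ 2 - 1| ≤ 1 := by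
        rw [abs_le]; constructor <;> nlinarith
      calc ‖(cutoff (4 * R) (a - z) ^ 2 - 1) * D z (u z) (u z)‖
          = |cutoff (4 * R) (a - z) ^ 2 - 1| * ‖D z (u z) (u z)‖ := by rw [norm_mul, Real.norm_eq_abs]
        _ ≤ 1 * (‖D z‖ * ‖u z‖ * ‖u z‖) := by
            refine mul_le_mul hc1 ?_ (norm_nonneg _) zero_le_one
            calc ‖D z (u z) (u z)‖ ≤ ‖D z (u z)‖ * ‖u z‖ := ContinuousLinearMap.le_opNorm _ _
              _ ≤ ‖D z‖ * ‖u z‖ * ‖u z‖ := by gcongr; exact ContinuousLinearMap.le_opNorm _ _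
        _ ≤ 1 * ((4 * R) * (16 * M * (‖a - z‖ ^ 4)⁻¹) * ‖u z‖ * ‖u z‖) := by
            gcongr
            exact hDn.trans (mul_le_mul_of_nonneg_right hxy (by positivity))
        _ = 64 * M * R * ((‖a - z‖ ^ 4)⁻¹ * ‖u z‖ ^ 2) := by ring
    · rw [indicator_of_notMem hz, mul_zero]
      have hz' : ‖a - z‖ ≤ 4 * R := not_lt.1 hz
      rw [cutoff_eq_one (by positivity) hz']
      simp
  -- integrate
  rw [e3, ← Real.norm_eq_abs]
  calc ‖∫ z, (D z (w z) (w z) - D z (u z) (u z))‖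
      ≤ ∫ z, 64 * M * R * S.indicator (fun z => (‖a - z‖ ^ 4)⁻¹ * ‖u z‖ ^ 2) z :=
        norm_integral_le_of_norm_le (hFi.const_mul _) (Eventually.of_forall hpt)
    _ = 64 * M * R * ∫ z, S.indicator (fun z => (‖a - z‖ ^ 4)⁻¹ * ‖u z‖ ^ 2) z := integral_const_mul _ _
    _ ≤ 64 * M * R * ∑' k : ℕ, ((2 : ℝ) ^ k * R)⁻¹ ^ 4 * ∫ z, cutoff ((2 : ℝ) ^ (k + 1) * R) (a - z) * ‖u z‖ ^ 2 :=
        mul_le_mul_of_nonneg_left hFle (by positivity)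

end Summit.NavierStokesRegularity.NavierStokesRegularity.Theorems.PoloidalWindowDoorPoloidalWindowRigiditySparseEnergyPressureSplitFar

end
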